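import Summits.AtomisticToContinuum.FouriersLaw.Theorems.HiddenChargeMazurOddChargeAlgebraBridge
import Summits.AtomisticToContinuum.FouriersLaw.Theorems.HiddenChargeMazurOddChargeAlgebraPeeling
import Summits.AtomisticToContinuum.FouriersLaw.Theorems.OddChargeExists.Negative.OddChargeExistsFalseOfNoLocalIntegrals

/-!
# Refutation of `HiddenChargeMazur.OddChargeExists` (stmt-AtomisticToContinuum-13511)

The crux asserts: at SOME admissible parameter point `(ω₂, lam, β, γ, T) > 0` the infinite pinned
anharmonic chain `pinnedChain ω₂ lam β γ` carries a finite-range POLYNOMIAL density `g`, ODD under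
momentum reversal, with a local conservation law `L(g ∘ box_R) = ψ ∘ box_{R+1} − ψ ∘ box_{R+1} ∘ shift`
and EXTENSIVE static overlap with the total current.  It is FALSE (as the planner expected — the item is
the route's kill switch):

* `OddChargeExists.Negative.oddChargeExists_needs_nonCoboundaryLaw` (previous lead, p152864): an extensive
  overlap forces the odd law to be NOT a shift-coboundary `h ∘ succ − h ∘ castSucc + k` (coboundaries
  telescope to an `O(1)` overlap);
* `OddChargeAlgebra.odd_law_coboundary` (this lead's line, files `HiddenChargeMazurOddChargeAlgebra*.lean`,
  blueprint `Cruxes/OddChargeExists/MATH.md`): for `lam ≠ 0`, `β ≠ 0` and ANY `ω₂`, EVERY momentum-odd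
  polynomial local conservation law of the infinite chain is a shift-coboundary — proved for all spans
  `D` by the left-aligned normal form, weight peeling to the homogeneous quartic chain, the symbol calculus
  isolating the leading `(span, momentum-degree)` pair, the two pair lemmas, and the parameter-free
  transport recursion for the leading p-linear member, whose forced solution clashes at the last
  equation by the explicit nonzero residual `2D·c·cub(q_0,q_1)·γ_{D−1}·∏γ_j²·q_{D+1}·clashQuad D`;
* `OddChargeAlgebra.oddPolynomialLaw_isCoboundary_of_ring` (the bridge) translates the ring statement
  into the crux's analytic vocabulary.

Classification: `refuted-substantive` — the load-bearing existence claim is false at every parameter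
point with `lam ≠ 0 ≠ β`; no side condition repairs it (the harmonic corner `lam = β = 0`, where odd
charges `q_0p_D − q_Dp_0` exist, is excluded by the crux's own binders and is a different physical
regime).  `barrier-candidate:` "no momentum-odd polynomial local conservation law of the pinned
anharmonic chain" is now a theorem (the certified NECESSARY condition of Fourier's law that the route
was built to extract); the route HiddenChargeMazur closes `refuted:OddChargeExists` with its bridge
items (StaticKubo, ThomsonBound, OpenMazurBridge) standing as instruments for the positive routes.
-/

namespace Summit.AtomisticToContinuum.FouriersLaw.Theorems

open Summit.AtomisticToContinuum.FouriersLaw.Theorems.OddChargeAlgebra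
open Summit.AtomisticToContinuum.FouriersLaw.Theorems.OddChargeExists.Negative

/-- **`OddChargeExists` is false** (`refuted-substantive`): the pinned anharmonic chain has no
momentum-odd polynomial local conservation law beyond shift-coboundaries (`odd_law_coboundary`, all
spans, all `lam ≠ 0 ≠ β`, any `ω₂`), whereas the crux's extensive current overlap would need one
(`oddChargeExists_needs_nonCoboundaryLaw`).  No repaired statement `C′` is offered: the witness-free
region is the whole admissible parameter set. [folklore] -/
theorem not_OddChargeExists :
    ¬ Summit.AtomisticToContinuum.FouriersLaw.Theses.HiddenChargeMazur.OddChargeExists := by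
  intro hE
  obtain ⟨ω₂, lam, β, γ, _hω, hl, hβ, _hγ, hP⟩ := oddChargeExists_needs_nonCoboundaryLaw hE
  obtain ⟨R, g, ψ, hg, hψ, hodd, hcons, hncob⟩ := hP _ rfl
  exact hncob (oddPolynomialLaw_isCoboundary_of_ring odd_law_coboundary ω₂ lam β γ hl.ne' hβ.ne' _ rfl
    R g ψ hg hψ hodd hcons)

end Summit.AtomisticToContinuum.FouriersLaw.Theorems
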